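import Summits.BirchSwinnertonDyer.BirchSwinnertonDyer.Theorems.CMKolyvaginAtInertTwoLowerLevelTwoNullPlaceAtTwo
import Summits.BirchSwinnertonDyer.BirchSwinnertonDyer.Theorems.CMKolyvaginAtInertTwoLowerLevelTwoClosureGenusPlaceAtTwo
import Summits.BirchSwinnertonDyer.BirchSwinnertonDyer.Theorems.CMKolyvaginAtInertTwoLowerWitnessUpgradeAtTwo
import Summits.BirchSwinnertonDyer.BirchSwinnertonDyer.Theorems.CMKolyvaginAtInertTwoGenusDefectDeepWitnessAtTwo
import Summits.BirchSwinnertonDyer.BirchSwinnertonDyer.Theorems.CMKolyvaginAtInertTwoPairSupplyCompositeAtTwo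
import Summits.BirchSwinnertonDyer.BirchSwinnertonDyer.Theorems.CMKolyvaginAtInertTwoShaCountJacobiCompositeAtTwo
import HarnessLib

/-!
# Route `CMKolyvaginAtInertTwo`, crux `CMKolyvaginExactAtInertTwo` (stmt-BirchSwinnertonDyer-24277):
# THE CRUX'S OWN STATEMENT ON ITS WHOLE PROVABLE SUB-HABITAT `Σ ≤ 1` — `#Ш(E_K)(2) = 2^{2M₀}` for EVERY odd `d_K ≠ −3` with
# one-bit genus defect (prime `|d_K|`, and the composite `d_K` with exactly one prime `q ∣ d_K` inert on `E[2]`), modulo the four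
# published inputs and Gross 1991 Prop. 3.7 (2)

Seat `bsd-line-cmk2-p1` g21 (cell `bsd-print-cf2`), `--supports stmt-BirchSwinnertonDyer-24277` (helper; closes nothing by name — the
booking of an aside / the restatement R1′ is the pen's call).  THEOREMS ONLY (no definition, no named fact, no `sorry`).
BSD is NOT proved by any of this.

`Σ := Σ_{q ∣ d_K} ([(Δ/q) = −1] + 2·[(Δ/q) = 1 ∧ a_q even]) = ord₂ C(W^{(d_K)})` (g15/g18).  g20 settled the composite-`d_K` residual of
24277 IN FORM: a level-`4` Gross witness gives `#Ш(E_K)(2)·2 = 2^{2M₀+Σ}` (mod prints), which is the crux's `2^{2M₀}` exactly on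
`Σ = 1`; g20's RESTATE-24277 option R1′ («add `Σ ≤ 1`») was closable on the UPPER side only (g18 file VII
`card_primaryComponent_sha_two_baseChange_le_pow_of_sum_defect_le_one`), the LOWER side being in the tree for prime `|d_K|` alone
(g19 W4c/W4d: the W-UP engine with ONE genus place).  THIS FILE closes the lower side on `Σ ≤ 1`: by file W4c″ the other primes of
`d_K` are NULL places (`H¹(ℚ_v, E[2]) = 0`), so the engine's two genus-place inputs exist (`exists_genusPlace_of_sum_defect_le_one`),
file W4c‴ runs g19's `k`-minimal closure with them, W4d's McCallum Cor. 4.5 steps upgrade to a level-`4` Gross witness, and g20's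
`pow_mul_pow_sum_defect_le_card_sha_two_baseChange_of_grossWitness_of_printedInputs` (with `Σ ≥ 1`, g15) gives `2^{2M₀} ≤ #Ш(E_K)(2)`.
* `exists_deep_primitive_two_of_certificate_of_sum_defect_le_one`, `exists_grossWitness_of_certificate_of_sum_defect_le_one`;
* `pow_le_card_primaryComponent_sha_two_baseChange_of_certificate_of_sum_defect_le_one_of_printedInputs` (`≥`);
* `card_primaryComponent_sha_two_baseChange_eq_pow_of_certificate_of_sum_defect_le_one_of_printedInputs` (`=`);
* **`stub_lower_of_sum_defect_le_one_of_printedInputs`** — the registered `stub_lower` signature VERBATIM + `Σ ≤ 1` + the five prints;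
* **`cmKolyvaginExactAtInertTwo_of_sum_defect_le_one_of_printedInputs`** — crux 24277's signature VERBATIM followed by `Σ ≤ 1`,
  `prop37_2_reductionCongruence_inert N_E W K` and the four prints (items 24148, 19921, 19273, 24149): RESTATE option R1′ is closable.
Residuals (honest): `Σ ≥ 3` (there the deep-witness value `2^{2M₀+Σ−1}` differs from the crux's — g20); the named fact (print); the
four prints.  BSD is NOT proved by any of this; nothing is closed by name.

References: [McCallumLMS1991] §4 Cor. 4.5, §5 Prop. 5.2, Thm. 5.4, Cor. 5.6; [Kolyvagin1991MathAnn] Thm. 2.2; [GrossLMS1991] Prop. 3.7 (2),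
Prop. 6.2; [Kramer1981] Prop. 3; [DokchitserDokchitserAnnals2010] Lemma 4.14; [GrossZagier1986]; [Milne1972ArithmeticAV] Thm. 1.
-/

set_option autoImplicit false
-- the Theorems namespace of this sub repeats the summit name by design (D-0017 nested layout)
set_option linter.dupNamespace false

noncomputable section

open scoped Classical

open WeierstrassCurve NumberField IsDedekindDomain Field Literature.NumberTheory.EllipticCurves
open Literature.NumberTheory.EllipticCurves.ModularForms
open Literature.NumberTheory.EllipticCurves.GrossLMS1991 (prop37_2_reductionCongruence_inert)
open Summit.BirchSwinnertonDyer.BirchSwinnertonDyer.Theorems.GenusExact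
open Summit.BirchSwinnertonDyer.Rank1Residual

namespace Summit.BirchSwinnertonDyer.BirchSwinnertonDyer.Theorems.KolyvaginLowerTwo

/-! ## §1 The witness upgrade on `Σ ≤ 1` -/

/-- **THE WITNESS UPGRADE ON H₂ ∩ {Σ ≤ 1}, modulo Gross 1991 Prop. 3.7 (2).**  `E ∈ H₂` (CM, `2` inert in the CM field, `ρ̄_{E,2}` onto,
odd Tamagawa product); `K` imaginary quadratic with `d_K` odd `≠ −3`, Heegner, genus defect `Σ ≤ 1`; a frame `(Dt, β, ι)`.  From a
square-free `n` of Zhang–Kolyvagin primes at `2` that are CM-inert (ANY index) and a datum `d` with `P(n) ∉ 2E(K[n])`: a square-free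
`n₀` ALL of whose primes are Zhang–Kolyvagin of index `≥ 2` with `Frob = Frob_∞` on `K(E[4])`, and a datum `e₀` with
`addOrderOf c₁(e₀) = 2` (file W4c″'s genus place fed to file W4c‴). [cite: McCallumLMS1991, §5 proof of Prop. 5.2]
[cite: GrossLMS1991, Prop. 3.7 (2), Prop. 6.2, §9] [cite: Kramer1981, Prop. 3] -/
theorem exists_deep_primitive_two_of_certificate_of_sum_defect_le_one (W : WeierstrassCurve ℚ) [W.IsElliptic]
    [W.IsGloballyMinimal] [NeZero (W.conductorNorm ℤ)] (hCM : W.HasCM) (hin : Rank1Residual.CMInert W 2)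
    (hρ2 : W.HasSurjectiveModNGaloisRep 2) (hT : Odd W.tamagawaProduct) {K : Type} [Field K] [NumberField K]
    (hK : IsImaginaryQuadratic K) (hodd : Odd (NumberField.discr K)) (h3 : NumberField.discr K ≠ -3)
    (hHe : SatisfiesHeegnerHypothesis (W.conductorNorm ℤ) K) (h37 : prop37_2_reductionCongruence_inert (W.conductorNorm ℤ) W K)
    (hdef : ∑ q ∈ (NumberField.discr K).natAbs.primeFactors,
        ((if jacobiSym W.Δ.num q = -1 then 1 else 0) +
          (if jacobiSym W.Δ.num q = 1 ∧ Even (W.frobeniusTrace q) then 2 else 0)) ≤ 1)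
    (Dt : ModularParametrizationData W (W.conductorNorm ℤ)) (β : ℤ) (ι : K →+* ℂ)
    [∀ j : ℕ, NumberField (ringClassField K ι j)]
    {n : ℕ} (d : KolyvaginHeegnerData Dt β ι n) (hn : Squarefree n)
    (hKoly : ∀ ℓ ∈ n.primeFactors, Zhang2014.IsKolyvaginPrime (W.conductorNorm ℤ) W K 2 ℓ ∧ Rank1Residual.CMInert W ℓ)
    (hPn : ¬ ∃ Q : (W.baseChange (ringClassField K ι n)).toAffine.Point, (2 : ℤ) • Q = d.derivedPoint) :
    ∃ (n₀ : ℕ) (e₀ : KolyvaginHeegnerData Dt β ι n₀), Squarefree n₀ ∧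
      (∀ q ∈ n₀.primeFactors, Zhang2014.IsKolyvaginPrime (W.conductorNorm ℤ) W K 2 q ∧ 2 ≤ Zhang2014.kolyvaginIndex W 2 q ∧
        FrobEqFrobInfty W K (2 ^ 2) q) ∧
      addOrderOf (e₀.kolyvaginClass Nat.prime_two 1) = 2 ^ 1 := by
  obtain ⟨q, u, -, hqd, hu, hPu, hdesc⟩ := exists_genusPlace_of_sum_defect_le_one W hK hodd hHe hdef
  exact exists_deep_primitive_two_of_certificate_of_genusPlace W hCM hin hρ2 hT hK hodd h3 hHe h37 hqd u hu hPu hdesc Dt β ι d hn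
    hKoly hPn

/-- **THE LEVEL-4 GROSS WITNESS FROM THE CRUX'S CERTIFICATE ON H₂ ∩ {Σ ≤ 1}, modulo Gross 1991 Prop. 3.7 (2)**: the all-deep primitive
product of `exists_deep_primitive_two_of_certificate_of_sum_defect_le_one` upgraded by McCallum's Cor. 4.5 at `2` (W4d's two steps
`not_two_dvd_derivedPoint_of_addOrderOf_kolyvaginClass_two_pow`, `addOrderOf_kolyvaginClass_two_eq_pow_of_not_two_dvd_single`) to a datum
`e₀` with `addOrderOf c₂(e₀) = 4`. [cite: McCallumLMS1991, §4 Cor. 4.5 and §5 proof of Prop. 5.2] [cite: GrossLMS1991, Prop. 3.7 (2)] -/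
theorem exists_grossWitness_of_certificate_of_sum_defect_le_one (W : WeierstrassCurve ℚ) [W.IsElliptic] [W.IsGloballyMinimal]
    [NeZero (W.conductorNorm ℤ)] (hCM : W.HasCM) (hin : Rank1Residual.CMInert W 2) (hρ2 : W.HasSurjectiveModNGaloisRep 2)
    (hT : Odd W.tamagawaProduct) {K : Type} [Field K] [NumberField K] (hK : IsImaginaryQuadratic K)
    (hodd : Odd (NumberField.discr K)) (h3 : NumberField.discr K ≠ -3)
    (hHe : SatisfiesHeegnerHypothesis (W.conductorNorm ℤ) K) (h37 : prop37_2_reductionCongruence_inert (W.conductorNorm ℤ) W K)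
    (hdef : ∑ q ∈ (NumberField.discr K).natAbs.primeFactors,
        ((if jacobiSym W.Δ.num q = -1 then 1 else 0) +
          (if jacobiSym W.Δ.num q = 1 ∧ Even (W.frobeniusTrace q) then 2 else 0)) ≤ 1)
    (Dt : ModularParametrizationData W (W.conductorNorm ℤ)) (β : ℤ) (ι : K →+* ℂ)
    {n : ℕ} (d : KolyvaginHeegnerData Dt β ι n) (hn : Squarefree n)
    (hKoly : ∀ ℓ ∈ n.primeFactors, Zhang2014.IsKolyvaginPrime (W.conductorNorm ℤ) W K 2 ℓ ∧ Rank1Residual.CMInert W ℓ)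
    (hPn : ¬ ∃ Q : (W.baseChange (ringClassField K ι n)).toAffine.Point, (2 : ℤ) • Q = d.derivedPoint) :
    ∃ (n₀ : ℕ) (e₀ : KolyvaginHeegnerData Dt β ι n₀), Squarefree n₀ ∧
      (∀ q ∈ n₀.primeFactors, Zhang2014.IsKolyvaginPrime (W.conductorNorm ℤ) W K 2 q ∧ 2 ≤ Zhang2014.kolyvaginIndex W 2 q ∧
        FrobEqFrobInfty W K (2 ^ 2) q) ∧
      addOrderOf (e₀.kolyvaginClass Nat.prime_two 2) = 2 ^ 2 := by
  haveI : ∀ j : ℕ, NumberField (ringClassField K ι j) := JET.numberField_ringClassField K hK ι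
  obtain ⟨n₀, e₀, hn₀, hn₀K, he₁⟩ := exists_deep_primitive_two_of_certificate_of_sum_defect_le_one W hCM hin hρ2 hT hK hodd h3 hHe
    h37 hdef Dt β ι d hn hKoly hPn
  have hn₀K1 : ∀ q ∈ n₀.primeFactors, Zhang2014.IsKolyvaginPrime (W.conductorNorm ℤ) W K 2 q ∧ 1 ≤ Zhang2014.kolyvaginIndex W 2 q :=
    fun q hq ↦ ⟨(hn₀K q hq).1, le_trans (by norm_num) (hn₀K q hq).2.1⟩
  have hn₀K2 : ∀ q ∈ n₀.primeFactors, Zhang2014.IsKolyvaginPrime (W.conductorNorm ℤ) W K 2 q ∧ 2 ≤ Zhang2014.kolyvaginIndex W 2 q :=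
    fun q hq ↦ ⟨(hn₀K q hq).1, (hn₀K q hq).2.1⟩
  have hprim := RelaxedCount.not_two_dvd_derivedPoint_of_addOrderOf_kolyvaginClass_two_pow W hK hodd h3 hHe hρ2 Dt β ι (L := 1)
    le_rfl hn₀ hn₀K1 e₀ he₁
  exact ⟨n₀, e₀, hn₀, hn₀K, RelaxedCount.addOrderOf_kolyvaginClass_two_eq_pow_of_not_two_dvd_single W hK hodd h3 hHe hρ2 Dt β ι
    (M := 2) (by norm_num) hn₀ hn₀K2 e₀ hprim⟩

/-! ## §2 The lower half, the equality, and the verbatim closers on `Σ ≤ 1` -/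

/-- **`2^{2M₀} ≤ #Ш(E_K)(2)` FROM THE REGISTERED CERTIFICATE on H₂ ∩ {Σ ≤ 1}, modulo the four prints + Gross 3.7 (2).**  24277's frame,
`M₀`-clause and certificate `(n, d)` verbatim, plus `Σ ≤ 1`, the four published inputs and `prop37_2_reductionCongruence_inert N_E W K`.
(`exists_grossWitness_of_certificate_of_sum_defect_le_one` + g20's `pow_mul_pow_sum_defect_le_card_sha_two_baseChange_of_grossWitness_…`,
the factor `2^{Σ} ≥ 2` by g15's `one_le_sum_defect_of_Δ_neg_of_heegner`, `Δ < 0` on H₂.)  BSD is NOT proved by this.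
[cite: McCallumLMS1991, §5 Prop. 5.2, Thm. 5.4, Cor. 5.6] [cite: Kolyvagin1991MathAnn, Thm. 2.2] [cite: GrossLMS1991, Prop. 3.7 (2)]
[cite: DokchitserDokchitserAnnals2010, Lemma 4.14 (proof)] -/
theorem pow_le_card_primaryComponent_sha_two_baseChange_of_certificate_of_sum_defect_le_one_of_printedInputs
    (hGZ : ∀ (N : ℕ) [NeZero N] (W : WeierstrassCurve ℚ) (K : Type) [Field K] [NumberField K], gross_zagier N W K)
    (hGZK : rank_eq_analyticRank_of_analyticRank_le_one) (hmod : hasEntireLFunction_rat)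
    (hMilneC : Milne1972.bsdQuotient_baseChange_quadratic_anyModel)
    (W : WeierstrassCurve ℚ) [W.IsElliptic] [W.IsGloballyMinimal] [NeZero (W.conductorNorm ℤ)]
    (hCM : W.HasCM) (hin : Rank1Residual.CMInert W 2) (hρ2 : W.HasSurjectiveModNGaloisRep 2)
    (hT : Odd W.tamagawaProduct) (K : Type) [Field K] [NumberField K] (hIQ : IsImaginaryQuadratic K)
    (hodd : Odd (NumberField.discr K)) (h3 : NumberField.discr K ≠ -3)
    (hHe : SatisfiesHeegnerHypothesis (W.conductorNorm ℤ) K)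
    (hdef : ∑ q ∈ (NumberField.discr K).natAbs.primeFactors,
        ((if jacobiSym W.Δ.num q = -1 then 1 else 0) +
          (if jacobiSym W.Δ.num q = 1 ∧ Even (W.frobeniusTrace q) then 2 else 0)) ≤ 1)
    (h37 : prop37_2_reductionCongruence_inert (W.conductorNorm ℤ) W K)
    (Dt : ModularParametrizationData W (W.conductorNorm ℤ)) (β : ℤ) (ι : K →+* ℂ) (d₁ : KolyvaginHeegnerData Dt β ι 1)
    (hy : ¬ IsOfFinAddOrder d₁.derivedPoint) (M₀ : ℕ)
    (hM₀ : ∃ Q : (W.baseChange (ringClassField K ι 1)).toAffine.Point, ((2 ^ M₀ : ℕ) : ℤ) • Q = d₁.derivedPoint)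
    (hndiv : ¬ ∃ Q : (W.baseChange (ringClassField K ι 1)).toAffine.Point, ((2 ^ (M₀ + 1) : ℕ) : ℤ) • Q = d₁.derivedPoint)
    {n : ℕ} (d : KolyvaginHeegnerData Dt β ι n) (hn : Squarefree n)
    (hKoly : ∀ ℓ ∈ n.primeFactors, Zhang2014.IsKolyvaginPrime (W.conductorNorm ℤ) W K 2 ℓ ∧ Rank1Residual.CMInert W ℓ)
    (hPn : ¬ ∃ Q : (W.baseChange (ringClassField K ι n)).toAffine.Point, (2 : ℤ) • Q = d.derivedPoint) :
    2 ^ (2 * M₀) ≤ Nat.card (AddCommGroup.primaryComponent (W.baseChange K).sha 2) := by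
  obtain ⟨n₀, e₀, hn₀, hn₀K, he₀⟩ := exists_grossWitness_of_certificate_of_sum_defect_le_one W hCM hin hρ2 hT hIQ hodd h3 hHe h37 hdef
    Dt β ι d hn hKoly hPn
  have hΔ : W.Δ < 0 := KolyvaginEigenTwo.Δ_neg_of_cmInert_two W hCM hin hρ2
  have hS1 := ShaCountTwo.one_le_sum_defect_of_Δ_neg_of_heegner W K hIQ hodd hHe hΔ
  have hw := KolyvaginGenusTwo.pow_mul_pow_sum_defect_le_card_sha_two_baseChange_of_grossWitness_of_printedInputs hGZ hGZK hmod hMilneC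
    W hCM hin hρ2 hT K hIQ hodd h3 hHe h37 Dt β ι d₁ hy M₀ hM₀ hndiv (L := 2 * M₀ + 12) (k := 1) le_rfl le_rfl hn₀ hn₀K e₀ he₀
  have h2 : 2 ^ (2 * M₀) * 2 ≤ Nat.card (AddCommGroup.primaryComponent (W.baseChange K).sha 2) * 2 :=
    calc 2 ^ (2 * M₀) * 2 = 2 ^ (2 * M₀) * 2 ^ 1 := by rw [pow_one]
      _ ≤ 2 ^ (2 * M₀) * 2 ^ ∑ q ∈ (NumberField.discr K).natAbs.primeFactors,
          ((if jacobiSym W.Δ.num q = -1 then 1 else 0) +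
            (if jacobiSym W.Δ.num q = 1 ∧ Even (W.frobeniusTrace q) then 2 else 0)) :=
        Nat.mul_le_mul_left _ (Nat.pow_le_pow_right two_pos hS1)
      _ ≤ _ := hw
  exact Nat.le_of_mul_le_mul_right h2 two_pos

/-- **`#Ш(E_K)(2) = 2^{2M₀}` ON H₂ ∩ {Σ ≤ 1} FROM THE CRUX'S CERTIFICATE, modulo the four prints + Gross 3.7 (2)**: `le_antisymm` of g18's
UPPER `KolyvaginPairSupplyTwo.card_primaryComponent_sha_two_baseChange_le_pow_of_sum_defect_le_one` (certificate-free) and the LOWER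
half above.  For prime `|d_K|` (`Σ = 1` by g15's Jacobi argument) this is g19's `card_primaryComponent_sha_two_baseChange_eq_pow_of_
certificate_of_printedInputs`; NEW are the composite `d_K` with one-bit defect.  BSD is NOT proved by this.
[cite: McCallumLMS1991, §5 Thm. 5.4] [cite: Kolyvagin1991MathAnn, Thm. 2.2] [cite: GrossLMS1991, Prop. 3.7 (2)] [cite: Kramer1981, Prop. 3] -/
theorem card_primaryComponent_sha_two_baseChange_eq_pow_of_certificate_of_sum_defect_le_one_of_printedInputs
    (hGZ : ∀ (N : ℕ) [NeZero N] (W : WeierstrassCurve ℚ) (K : Type) [Field K] [NumberField K], gross_zagier N W K)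
    (hGZK : rank_eq_analyticRank_of_analyticRank_le_one) (hmod : hasEntireLFunction_rat)
    (hMilneC : Milne1972.bsdQuotient_baseChange_quadratic_anyModel)
    (W : WeierstrassCurve ℚ) [W.IsElliptic] [W.IsGloballyMinimal] [NeZero (W.conductorNorm ℤ)]
    (hCM : W.HasCM) (hin : Rank1Residual.CMInert W 2) (hρ2 : W.HasSurjectiveModNGaloisRep 2)
    (hT : Odd W.tamagawaProduct) (K : Type) [Field K] [NumberField K] (hIQ : IsImaginaryQuadratic K)
    (hodd : Odd (NumberField.discr K)) (h3 : NumberField.discr K ≠ -3)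
    (hHe : SatisfiesHeegnerHypothesis (W.conductorNorm ℤ) K)
    (hdef : ∑ q ∈ (NumberField.discr K).natAbs.primeFactors,
        ((if jacobiSym W.Δ.num q = -1 then 1 else 0) +
          (if jacobiSym W.Δ.num q = 1 ∧ Even (W.frobeniusTrace q) then 2 else 0)) ≤ 1)
    (h37 : prop37_2_reductionCongruence_inert (W.conductorNorm ℤ) W K)
    (Dt : ModularParametrizationData W (W.conductorNorm ℤ)) (β : ℤ) (ι : K →+* ℂ) (d₁ : KolyvaginHeegnerData Dt β ι 1)
    (hy : ¬ IsOfFinAddOrder d₁.derivedPoint) (M₀ : ℕ)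
    (hM₀ : ∃ Q : (W.baseChange (ringClassField K ι 1)).toAffine.Point, ((2 ^ M₀ : ℕ) : ℤ) • Q = d₁.derivedPoint)
    (hndiv : ¬ ∃ Q : (W.baseChange (ringClassField K ι 1)).toAffine.Point, ((2 ^ (M₀ + 1) : ℕ) : ℤ) • Q = d₁.derivedPoint)
    {n : ℕ} (d : KolyvaginHeegnerData Dt β ι n) (hn : Squarefree n)
    (hKoly : ∀ ℓ ∈ n.primeFactors, Zhang2014.IsKolyvaginPrime (W.conductorNorm ℤ) W K 2 ℓ ∧ Rank1Residual.CMInert W ℓ)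
    (hPn : ¬ ∃ Q : (W.baseChange (ringClassField K ι n)).toAffine.Point, (2 : ℤ) • Q = d.derivedPoint) :
    Nat.card (AddCommGroup.primaryComponent (W.baseChange K).sha 2) = 2 ^ (2 * M₀) :=
  le_antisymm
    (KolyvaginPairSupplyTwo.card_primaryComponent_sha_two_baseChange_le_pow_of_sum_defect_le_one W hGZ hGZK hmod hMilneC hCM hin hρ2
      hT hIQ hodd h3 hHe h37 hdef Dt β ι d₁ hy M₀ hM₀ hndiv)
    (pow_le_card_primaryComponent_sha_two_baseChange_of_certificate_of_sum_defect_le_one_of_printedInputs hGZ hGZK hmod hMilneC W hCM hin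
      hρ2 hT K hIQ hodd h3 hHe hdef h37 Dt β ι d₁ hy M₀ hM₀ hndiv d hn hKoly hPn)

/-- **The registered `stub_lower` signature VERBATIM, followed by the extra hypotheses `Σ ≤ 1`, Gross 3.7 (2) by name and the four
published inputs** (the two `¬ IsSquare` clauses of the crux are unused).  BSD is NOT proved by this; nothing is closed by name.
[cite: McCallumLMS1991, §5 Thm. 5.4] [cite: GrossLMS1991, Prop. 3.7 (2)] -/
theorem stub_lower_of_sum_defect_le_one_of_printedInputs :
    ∀ (W : WeierstrassCurve ℚ) [W.IsElliptic] [W.IsGloballyMinimal] [NeZero (W.conductorNorm ℤ)], W.HasCM → Literature.NumberTheory.EllipticCurves.Rank1Residual.CMInert W 2 → W.HasSurjectiveModNGaloisRep (2 : ℤ) → Odd W.tamagawaProduct → ∀ (K : Type) [Field K] [NumberField K], Literature.NumberTheory.EllipticCurves.IsImaginaryQuadratic K → Odd (NumberField.discr K) → NumberField.discr K ≠ -3 → Literature.NumberTheory.EllipticCurves.SatisfiesHeegnerHypothesis (W.conductorNorm ℤ) K → ¬ IsSquare ((NumberField.discr K : ℚ) * -|W.Δ|) → ¬ IsSquare ((NumberField.discr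 K : ℚ) * (-(2 * |W.Δ|))) → ∀ (Dt : Literature.NumberTheory.EllipticCurves.ModularForms.ModularParametrizationData W (W.conductorNorm ℤ)) (β : ℤ) (ι : K →+* ℂ) (d₁ : Literature.NumberTheory.EllipticCurves.KolyvaginHeegnerData Dt β ι 1), ¬ IsOfFinAddOrder d₁.derivedPoint → ∀ (M₀ : ℕ), (∃ Q : (W.baseChange (Literature.NumberTheory.EllipticCurves.ringClassField K ι 1)).toAffine.Point, ((2 ^ M₀ : ℕ) : ℤ) • Q = d₁.derivedPoint) → (¬ ∃ Q : (W.baseChange (Literature.NumberTheory.EllipticCurves.ringClassField K ι 1)).toAffine.Point, ((2 ^ (M₀ + 1) : ℕ) : ℤ) • Q = d₁.derivedPoint) → ∀ (n : ℕ) (d : Literature.NumberTheory.EllipticCurves.KolyvaginHeegnerData Dt β ι n), Squarefree n → (∀ ℓ ∈ n.primeFactors, (Literature.NumberTheory.EllipticCurves.Zhang2014.IsKolyvaginPrime (W.conductorNorm ℤ) W K 2 ℓ ∧ Literature.NumberTheory.EllipticCurves.Rank1Residual.CMInert W ℓ)) → (¬ ∃ Q : (W.baseChange (Literature.NumberTheory.EllipticCurves.ringClassField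 K ι n)).toAffine.Point, (2 : ℤ) • Q = d.derivedPoint) →
      -- the extra hypotheses
      (∑ q ∈ (NumberField.discr K).natAbs.primeFactors,
        ((if jacobiSym W.Δ.num q = -1 then 1 else 0) +
          (if jacobiSym W.Δ.num q = 1 ∧ Even (W.frobeniusTrace q) then 2 else 0)) ≤ 1) →
      Literature.NumberTheory.EllipticCurves.GrossLMS1991.prop37_2_reductionCongruence_inert (W.conductorNorm ℤ) W K →
      (∀ (N : ℕ) [NeZero N] (W : WeierstrassCurve ℚ) (K : Type) [Field K] [NumberField K], gross_zagier N W K) →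
      rank_eq_analyticRank_of_analyticRank_le_one → hasEntireLFunction_rat → Milne1972.bsdQuotient_baseChange_quadratic_anyModel →
      2 ^ (2 * M₀) ≤ Nat.card (AddCommGroup.primaryComponent (W.baseChange K).sha 2) := by
  intro W _ _ _ hCM hin hρ hT K _ _ hK hodd h3 hH _ _ Dt β ι d₁ hy M₀ hdiv hndiv n d hn hKoly hPn hdef h37 hGZ hGZK hmod hMi
  exact pow_le_card_primaryComponent_sha_two_baseChange_of_certificate_of_sum_defect_le_one_of_printedInputs hGZ hGZK hmod hMi W hCM hin
    hρ hT K hK hodd h3 hH hdef h37 Dt β ι d₁ hy M₀ hdiv hndiv d hn hKoly hPn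

/-- **Crux 24277's signature VERBATIM, followed by `Σ ≤ 1`, Gross 3.7 (2) by name and the four prints** ⟹ the crux's conclusion
`Nat.card (Ш(E_K)(2)) = 2^(2·M₀)`: what the route's exactness crux IS on its whole provable sub-habitat `Σ ≤ 1` — g20's RESTATE-24277
option R1′ — as a conditional tree theorem (g19's `cmKolyvaginExactAtInertTwo_of_prime_of_printedInputs` is the case `|d_K|` prime).
BSD is NOT proved by this; nothing is closed by name. [cite: McCallumLMS1991, §5 Thm. 5.4, Thm. 5.8] [cite: GrossLMS1991, Prop. 3.7 (2)]
[cite: Kramer1981, Prop. 3] -/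
theorem cmKolyvaginExactAtInertTwo_of_sum_defect_le_one_of_printedInputs :
    ∀ (W : WeierstrassCurve ℚ) [W.IsElliptic] [W.IsGloballyMinimal] [NeZero (W.conductorNorm ℤ)], W.HasCM → Literature.NumberTheory.EllipticCurves.Rank1Residual.CMInert W 2 → W.HasSurjectiveModNGaloisRep (2 : ℤ) → Odd W.tamagawaProduct → ∀ (K : Type) [Field K] [NumberField K], Literature.NumberTheory.EllipticCurves.IsImaginaryQuadratic K → Odd (NumberField.discr K) → NumberField.discr K ≠ -3 → Literature.NumberTheory.EllipticCurves.SatisfiesHeegnerHypothesis (W.conductorNorm ℤ) K → ¬ IsSquare ((NumberField.discr K : ℚ) * -|W.Δ|) → ¬ IsSquare ((NumberField.discr K : ℚ) * (-(2 * |W.Δ|))) → ∀ (Dt : Literature.NumberTheory.EllipticCurves.ModularForms.ModularParametrizationData W (W.conductorNorm ℤ)) (β : ℤ) (ι : K →+* ℂ) (d₁ : Literature.NumberTheory.EllipticCurves.KolyvaginHeegnerData Dt β ι 1), ¬ IsOfFinAddOrder d₁.derivedPoint → ∀ (M₀ : ℕ), (∃ Q : (W.baseChange (Literature.NumberTheory.EllipticCurves.ringClassField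 K ι 1)).toAffine.Point, ((2 ^ M₀ : ℕ) : ℤ) • Q = d₁.derivedPoint) → (¬ ∃ Q : (W.baseChange (Literature.NumberTheory.EllipticCurves.ringClassField K ι 1)).toAffine.Point, ((2 ^ (M₀ + 1) : ℕ) : ℤ) • Q = d₁.derivedPoint) → ∀ (n : ℕ) (d : Literature.NumberTheory.EllipticCurves.KolyvaginHeegnerData Dt β ι n), Squarefree n → (∀ ℓ ∈ n.primeFactors, (Literature.NumberTheory.EllipticCurves.Zhang2014.IsKolyvaginPrime (W.conductorNorm ℤ) W K 2 ℓ ∧ Literature.NumberTheory.EllipticCurves.Rank1Residual.CMInert W ℓ)) → (¬ ∃ Q : (W.baseChange (Literature.NumberTheory.EllipticCurves.ringClassField K ι n)).toAffine.Point, (2 : ℤ) • Q = d.derivedPoint) →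
      -- the extra hypotheses
      (∑ q ∈ (NumberField.discr K).natAbs.primeFactors,
        ((if jacobiSym W.Δ.num q = -1 then 1 else 0) +
          (if jacobiSym W.Δ.num q = 1 ∧ Even (W.frobeniusTrace q) then 2 else 0)) ≤ 1) →
      Literature.NumberTheory.EllipticCurves.GrossLMS1991.prop37_2_reductionCongruence_inert (W.conductorNorm ℤ) W K →
      (∀ (N : ℕ) [NeZero N] (W : WeierstrassCurve ℚ) (K : Type) [Field K] [NumberField K], gross_zagier N W K) →
      rank_eq_analyticRank_of_analyticRank_le_one → hasEntireLFunction_rat → Milne1972.bsdQuotient_baseChange_quadratic_anyModel →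
      Nat.card (AddCommGroup.primaryComponent (W.baseChange K).sha 2) = 2 ^ (2 * M₀) := by
  intro W _ _ _ hCM hin hρ hT K _ _ hK hodd h3 hH _ _ Dt β ι d₁ hy M₀ hdiv hndiv n d hn hKoly hPn hdef h37 hGZ hGZK hmod hMi
  exact card_primaryComponent_sha_two_baseChange_eq_pow_of_certificate_of_sum_defect_le_one_of_printedInputs hGZ hGZK hmod hMi W hCM
    hin hρ hT K hK hodd h3 hH hdef h37 Dt β ι d₁ hy M₀ hdiv hndiv d hn hKoly hPn

end Summit.BirchSwinnertonDyer.BirchSwinnertonDyer.Theorems.KolyvaginLowerTwo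

end
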